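import Literature.RingTheory.MvPolynomial.HilbertFunctionBounds
import Mathlib.Analysis.Polynomial.Basic
import Mathlib.Algebra.Polynomial.Taylor
import Mathlib.Topology.Instances.Rat
import HarnessLib

/-!
# The degree of the Hilbert polynomial is the dimension

Topic: `Literature/RingTheory/MvPolynomial`. For a homogeneous ideal `I ⊆ S = K[X_0, …, X_{m-1}]`
over an infinite field with `dim S/I = b + 1`, the Hilbert polynomial `P_I`
(`HilbertPolynomialExists.lean`) has degree exactly `b` and leading coefficient `≥ 1/b!`
(Hartshorne, *Algebraic Geometry*, I.7.5 and Prop. I.7.6 (a): "deg P_Y = dim Y"; the degree of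
`I`, `b! · lc(P_I)`, is classically a positive integer — here only `≥ 1` is recorded), from the
bounds `binom(t + b, b) ≤ H(I; t) ≤ C (t+1)^b` of `HilbertFunctionBounds.lean`:

* `leadingCoeff_pos_of_eventually_nonneg` — a non-zero rational polynomial eventually `≥ 0` on `ℕ`
  has positive leading coefficient (Mathlib `Polynomial.tendsto_atBot_of_leadingCoeff_nonpos`);
* `eval_binomPolynomial` — `binom(t + b, b)` is the value of `(1/b!)·(T+1)⋯(T+b)`;
* **`natDegree_hilbertPolynomial`** — for homogeneous `I` with `dim S/I = b + 1`, any polynomial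
  agreeing with `H(I; ·)` for large `t` has `natDegree = b` and leading coefficient `≥ 1/b!`;
  `natDegree_hilbertPolynomial_le`, `coeff_hilbertPolynomial_eq_zero_of_ringKrullDim_le` — the
  upper bound alone (`dim S/I ≤ b + 1 ⇒ natDegree ≤ b`, `dim S/I ≤ b ⇒ coeff b = 0`);
* `coeff_hilbertPolynomial_inf` — additivity `coeff_b P_{I ∩ J} = coeff_b P_I + coeff_b P_J` when
  `coeff_b P_{I+J} = 0` (from `H(I ∩ J) + H(I + J) = H(I) + H(J)`; Nesterenko–Philippon LNM 1752
  Ch. 11 §2.2 (ii), the part "`deg I = Σ deg 𝔮_i`" in the inequality form used for counting);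
* `natDegree_taylor_sub`, `leadingCoeff_taylor_sub` — `P(T + d) - P(T)` has degree `deg P - 1` and
  leading coefficient `d · deg P · lc P`;
* **`leadingCoeff_hilbertPolynomial_le_of_hypersurface`** — Bézout's Lemma in leading-coefficient
  form (LNM 1752 Ch. 11 §2.2 (iii); Philippon 1986 Lemme 3.1): if `Q` is a form of degree `D` which
  is a non-zero-divisor modulo the homogeneous ideal `J`, and `J' ⊇ J + (Q)` is homogeneous with
  `deg P_{J'} = deg P_J - 1`, then `lc(P_{J'}) ≤ D · deg(P_J) · lc(P_J)`, i.e.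
  `𝓗(J'; D) ≤ 𝓗(J; D)` for `𝓗(I; D) = deg(I) D^{dim}`.

## References

* R. Hartshorne, *Algebraic Geometry*, GTM 52 (1977), Ch. I, Thm. 7.5, Prop. 7.6. [Hartshorne1977]
* Yu. V. Nesterenko, P. Philippon (eds.), *Introduction to Algebraic Independence Theory*,
  LNM 1752 (2001), Ch. 11 (D. Roy), §2.2 (ii), (iii). [NesterenkoPhilippon2001]
* P. Philippon, *Lemmes de zéros dans les groupes algébriques commutatifs*, Bull. Soc. Math.
  France 114 (1986), Lemme 3.1. [Philippon1986]
-/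

noncomputable section

open Module Polynomial Filter

attribute [local instance] MvPolynomial.gradedAlgebra

namespace Literature.RingTheory.MvPolynomial

variable {K : Type*} [Field K] {m : ℕ}

local notation "hilb(" I ", " t ")" =>
  (Module.finrank K (MvPolynomial.homogeneousSubmodule (Fin m) K t) -
    Module.finrank K (idealDegree I t))

/-! ## Degree and leading coefficient of the Hilbert polynomial -/

/-- **A non-zero rational polynomial which is eventually non-negative on the natural numbers has
positive leading coefficient.** [folklore] -/
theorem leadingCoeff_pos_of_eventually_nonneg {R : ℚ[X]} (hR : R ≠ 0) {t₀ : ℕ}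
    (h : ∀ t : ℕ, t₀ ≤ t → 0 ≤ R.eval (t : ℚ)) : 0 < R.leadingCoeff := by
  by_contra hle
  push Not at hle
  by_cases hdeg : R.degree ≤ 0
  · -- constant polynomial
    have hC := Polynomial.eq_C_of_degree_le_zero hdeg
    have h0 := h t₀ le_rfl
    rw [hC, eval_C] at h0
    have : R.leadingCoeff = R.coeff 0 := by rw [hC, leadingCoeff_C, coeff_C_zero]
    have hne : R.coeff 0 ≠ 0 := by
      intro h0'; apply hR; rw [hC, h0', map_zero]
    rw [this] at hle
    exact absurd (le_antisymm hle h0) hne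
  · push Not at hdeg
    have htend := R.tendsto_atBot_of_leadingCoeff_nonpos hdeg hle
    have htend' := htend.comp tendsto_natCast_atTop_atTop
    have hev : ∀ᶠ t : ℕ in atTop, R.eval (t : ℚ) < 0 := htend'.eventually_lt_atBot 0
    have hev' : ∀ᶠ t : ℕ in atTop, 0 ≤ R.eval (t : ℚ) := eventually_atTop.mpr ⟨t₀, h⟩
    obtain ⟨t, ht⟩ := (hev.and hev').exists
    exact absurd ht.2 (not_le.mpr ht.1)

/-- The reference polynomial `B_b` with `B_b(t) = binom(t + b, b)`: the Hilbert polynomial of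
the polynomial ring in `b + 1` variables, of degree `b` and leading coefficient `1/b!`.
[folklore] -/
theorem eval_binomPolynomial (b t : ℕ) :
    (Polynomial.C (((b.factorial : ℕ) : ℚ)⁻¹) * (ascPochhammer ℚ b).comp (X + 1)).eval (t : ℚ) =
      ((t + b).choose b : ℚ) := by
  have h := finrank_homogeneousSubmodule_eq_eval (K := ℚ) (b + 1) t (by omega)
  rw [Nat.add_sub_cancel] at h
  rw [← h, Literature.RingTheory.HilbertSamuel.finrank_homogeneousSubmodule_fin,
    show t + (b + 1) - 1 = t + b by omega, Nat.choose_symm_add]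

/-- **The degree of the Hilbert polynomial is the dimension** (Hartshorne I.7.5 / I.7.6 (a)): for a
homogeneous ideal `I` of `K[X_0, …, X_{m-1}]` (`K` infinite) with `dim S/I = b + 1`, a polynomial
`P` with `H(I; t) = P(t)` for `t ≫ 0` has `natDegree P = b` and leading coefficient `≥ 1/b!`
(so that `deg I := b! · lc(P) ≥ 1`). [cite: Hartshorne1977, Ch. I Thm. 7.5] -/
theorem natDegree_hilbertPolynomial [Infinite K] {I : Ideal (MvPolynomial (Fin m) K)}
    (hI : I.IsHomogeneous (MvPolynomial.homogeneousSubmodule (Fin m) K)) {b : ℕ}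
    (hdim : ringKrullDim (MvPolynomial (Fin m) K ⧸ I) = (b + 1 : ℕ)) {P : ℚ[X]} {t₀ : ℕ}
    (hP : ∀ t, t₀ ≤ t → ((hilb(I, t) : ℕ) : ℚ) = P.eval (t : ℚ)) :
    P.natDegree = b ∧ (((b.factorial : ℕ) : ℚ)⁻¹) ≤ P.leadingCoeff := by
  classical
  -- lower bound through a minimal prime of dimension `b + 1`
  obtain ⟨𝔭, h𝔭, h𝔭dim⟩ := exists_minimalPrimes_ringKrullDim_quotient_eq hdim
  haveI : 𝔭.IsPrime := h𝔭.1.1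
  have hlow : ∀ t, ((t + b).choose b : ℚ) ≤ ((hilb(I, t) : ℕ) : ℚ) := fun t => by
    exact_mod_cast (choose_le_hilbert_of_isPrime h𝔭dim t).trans (hilbert_antitone h𝔭.1.2 t)
  obtain ⟨C, hC⟩ := hilbert_le_mul_pow b I hI hdim.le
  set B : ℚ[X] := Polynomial.C (((b.factorial : ℕ) : ℚ)⁻¹) * (ascPochhammer ℚ b).comp (X + 1)
    with hB
  have hBdeg := natDegree_leadingCoeff_hilbertPolynomial_top (b + 1)
  rw [Nat.add_sub_cancel, ← hB] at hBdeg
  -- `P ≥ B` eventually, so `P ≠ 0` and `lc P > 0`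
  have hPB : ∀ t : ℕ, t₀ ≤ t → 0 ≤ (P - B).eval (t : ℚ) := fun t ht => by
    rw [eval_sub, ← hP t ht, eval_binomPolynomial, sub_nonneg]
    exact hlow t
  have hP0 : P ≠ 0 := by
    intro h0
    have := hPB t₀ le_rfl
    rw [h0, zero_sub, eval_neg, eval_binomPolynomial, neg_nonneg] at this
    have hpos : (0 : ℚ) < ((t₀ + b).choose b : ℚ) := by exact_mod_cast Nat.choose_pos (by omega)
    exact absurd this (not_le.mpr hpos)
  have hlcP : 0 < P.leadingCoeff :=
    leadingCoeff_pos_of_eventually_nonneg hP0 (t₀ := t₀) fun t ht => by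
      rw [← hP t ht]; exact_mod_cast Nat.zero_le _
  -- upper bound: `natDegree P ≤ b`
  have hup : P.natDegree ≤ b := by
    by_contra hgt
    push Not at hgt
    set U : ℚ[X] := Polynomial.C (C : ℚ) * (X + 1) ^ b with hU
    have hUdeg : U.natDegree ≤ b := by
      rw [hU]
      refine (natDegree_C_mul_le _ _).trans ?_
      rw [show (X + 1 : ℚ[X]) = X + Polynomial.C 1 by rw [map_one], natDegree_pow, natDegree_X_add_C,
        mul_one]
    have hR0 : U - P ≠ 0 := by
      intro h0
      rw [sub_eq_zero] at h0
      rw [← h0] at hgt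
      exact absurd hUdeg (not_le.mpr hgt)
    have hlc : (U - P).leadingCoeff = -P.leadingCoeff := by
      rw [sub_eq_neg_add, leadingCoeff_add_of_degree_lt', leadingCoeff_neg]
      rw [degree_neg]
      exact lt_of_le_of_lt (degree_le_of_natDegree_le hUdeg)
        (by rw [degree_eq_natDegree hP0]; exact_mod_cast hgt)
    have hpos := leadingCoeff_pos_of_eventually_nonneg hR0 (t₀ := t₀) fun t ht => by
      rw [eval_sub, ← hP t ht, sub_nonneg, hU, eval_mul, eval_C, eval_pow, eval_add, eval_X,
        eval_one]
      exact_mod_cast hC t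
    rw [hlc] at hpos
    linarith
  -- the coefficient of `X^b`: `coeff b P ≥ 1/b!`
  have hcoeff : (((b.factorial : ℕ) : ℚ)⁻¹) ≤ P.coeff b := by
    by_contra hlt
    push Not at hlt
    have hRb : (P - B).coeff b = P.coeff b - (((b.factorial : ℕ) : ℚ)⁻¹) := by
      rw [coeff_sub, ← hBdeg.2, Polynomial.leadingCoeff, hBdeg.1]
    have hRdeg_le : (P - B).natDegree ≤ b :=
      (natDegree_sub_le _ _).trans (max_le hup hBdeg.1.le)
    have hRne : (P - B).coeff b ≠ 0 := by rw [hRb]; linarith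
    have hRdeg : (P - B).natDegree = b :=
      le_antisymm hRdeg_le (le_natDegree_of_ne_zero hRne)
    have hR0 : P - B ≠ 0 := fun h => hRne (by rw [h, coeff_zero])
    have hpos := leadingCoeff_pos_of_eventually_nonneg hR0 hPB
    rw [Polynomial.leadingCoeff, hRdeg, hRb] at hpos
    linarith
  have hfac : (0 : ℚ) < (((b.factorial : ℕ) : ℚ)⁻¹) :=
    inv_pos.mpr (by exact_mod_cast b.factorial_pos)
  have hdegP : P.natDegree = b :=
    le_antisymm hup (le_natDegree_of_ne_zero (by linarith : P.coeff b ≠ 0) |> fun h => by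
      exact h)
  refine ⟨hdegP, ?_⟩
  rw [Polynomial.leadingCoeff, hdegP]
  exact hcoeff


/-- **Upper bound alone**: if `dim S/I ≤ b + 1` then a polynomial agreeing with `H(I; ·)` for large
`t` has `natDegree ≤ b`. [cite: Hartshorne1977, Ch. I Thm. 7.5] -/
theorem natDegree_hilbertPolynomial_le [Infinite K] {I : Ideal (MvPolynomial (Fin m) K)}
    (hI : I.IsHomogeneous (MvPolynomial.homogeneousSubmodule (Fin m) K)) {b : ℕ}
    (hdim : ringKrullDim (MvPolynomial (Fin m) K ⧸ I) ≤ (b + 1 : ℕ)) {P : ℚ[X]} {t₀ : ℕ}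
    (hP : ∀ t, t₀ ≤ t → ((hilb(I, t) : ℕ) : ℚ) = P.eval (t : ℚ)) : P.natDegree ≤ b := by
  by_cases hP0 : P = 0
  · rw [hP0, natDegree_zero]; exact Nat.zero_le _
  obtain ⟨C, hC⟩ := hilbert_le_mul_pow b I hI hdim
  have hlcP : 0 < P.leadingCoeff :=
    leadingCoeff_pos_of_eventually_nonneg hP0 (t₀ := t₀) fun t ht => by
      rw [← hP t ht]; exact_mod_cast Nat.zero_le _
  by_contra hgt
  push Not at hgt
  set U : ℚ[X] := Polynomial.C (C : ℚ) * (X + 1) ^ b with hU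
  have hUdeg : U.natDegree ≤ b := by
    rw [hU]
    refine (natDegree_C_mul_le _ _).trans ?_
    rw [show (X + 1 : ℚ[X]) = X + Polynomial.C 1 by rw [map_one], natDegree_pow, natDegree_X_add_C,
      mul_one]
  have hR0 : U - P ≠ 0 := by
    intro h0
    rw [sub_eq_zero] at h0
    rw [← h0] at hgt
    exact absurd hUdeg (not_le.mpr hgt)
  have hlc : (U - P).leadingCoeff = -P.leadingCoeff := by
    rw [sub_eq_neg_add, leadingCoeff_add_of_degree_lt', leadingCoeff_neg]
    rw [degree_neg]
    exact lt_of_le_of_lt (degree_le_of_natDegree_le hUdeg)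
      (by rw [degree_eq_natDegree hP0]; exact_mod_cast hgt)
  have hpos := leadingCoeff_pos_of_eventually_nonneg hR0 (t₀ := t₀) fun t ht => by
    rw [eval_sub, ← hP t ht, sub_nonneg, hU, eval_mul, eval_C, eval_pow, eval_add, eval_X,
      eval_one]
    exact_mod_cast hC t
  rw [hlc] at hpos
  linarith

/-- If `dim S/I ≤ b` then the coefficient of `T^b` of a polynomial agreeing with `H(I; ·)` for large
`t` vanishes (for `b = 0`: `H(I; t) = 0` eventually, so the polynomial is `0`). [folklore] -/
theorem coeff_hilbertPolynomial_eq_zero_of_ringKrullDim_le [Infinite K]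
    {I : Ideal (MvPolynomial (Fin m) K)}
    (hI : I.IsHomogeneous (MvPolynomial.homogeneousSubmodule (Fin m) K)) {b : ℕ}
    (hdim : ringKrullDim (MvPolynomial (Fin m) K ⧸ I) ≤ b) {P : ℚ[X]} {t₀ : ℕ}
    (hP : ∀ t, t₀ ≤ t → ((hilb(I, t) : ℕ) : ℚ) = P.eval (t : ℚ)) : P.coeff b = 0 := by
  cases b with
  | zero =>
    obtain ⟨t₁, ht₁⟩ := hilbert_eq_zero_of_X_pow_mem
      (exists_X_pow_mem_of_ringKrullDim_le_zero hI (by exact_mod_cast hdim))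
    have hP0 : P = 0 := by
      apply Polynomial.eq_of_infinite_eval_eq P 0
      apply Set.infinite_of_forall_exists_gt
      intro q
      obtain ⟨t, ht⟩ := exists_nat_gt q
      refine ⟨((max t (max t₀ t₁) : ℕ) : ℚ), ?_, ?_⟩
      · change P.eval _ = (0 : ℚ[X]).eval _
        rw [eval_zero, ← hP _ (le_trans (le_max_left _ _) (le_max_right _ _)),
          ht₁ _ (le_trans (le_max_right _ _) (le_max_right _ _)), Nat.cast_zero]
      · exact ht.trans_le (by exact_mod_cast le_max_left _ _)
    rw [hP0, coeff_zero]
  | succ b =>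
    have h := natDegree_hilbertPolynomial_le hI (b := b) (by exact_mod_cast hdim) hP
    exact coeff_eq_zero_of_natDegree_lt (by omega)

/-- **Additivity of the top coefficient over components** (LNM 1752 Ch. 11 §2.2 (ii), inequality
form): for homogeneous `I`, `J` with Hilbert polynomials `P_I, P_J, P_{I ∩ J}, P_{I+J}`, if
`coeff_b P_{I+J} = 0` then `coeff_b P_{I ∩ J} = coeff_b P_I + coeff_b P_J` (the polynomial identity
`P_{I ∩ J} + P_{I + J} = P_I + P_J`). [cite: NesterenkoPhilippon2001, Ch. 11 §2.2 (ii)] -/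
theorem coeff_hilbertPolynomial_inf {I J : Ideal (MvPolynomial (Fin m) K)}
    (hI : I.IsHomogeneous (MvPolynomial.homogeneousSubmodule (Fin m) K))
    (hJ : J.IsHomogeneous (MvPolynomial.homogeneousSubmodule (Fin m) K))
    {PI PJ Pinf Psup : ℚ[X]} {t₀ : ℕ}
    (hPI : ∀ t, t₀ ≤ t → ((hilb(I, t) : ℕ) : ℚ) = PI.eval (t : ℚ))
    (hPJ : ∀ t, t₀ ≤ t → ((hilb(J, t) : ℕ) : ℚ) = PJ.eval (t : ℚ))
    (hPinf : ∀ t, t₀ ≤ t → ((hilb(I ⊓ J, t) : ℕ) : ℚ) = Pinf.eval (t : ℚ))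
    (hPsup : ∀ t, t₀ ≤ t → ((hilb(I ⊔ J, t) : ℕ) : ℚ) = Psup.eval (t : ℚ))
    {b : ℕ} (hb : Psup.coeff b = 0) : Pinf.coeff b = PI.coeff b + PJ.coeff b := by
  have hid : Pinf + Psup = PI + PJ := by
    apply Polynomial.eq_of_infinite_eval_eq
    apply Set.infinite_of_forall_exists_gt
    intro q
    obtain ⟨t, ht⟩ := exists_nat_gt q
    refine ⟨((max t t₀ : ℕ) : ℚ), ?_, ht.trans_le (by exact_mod_cast le_max_left _ _)⟩
    change (Pinf + Psup).eval _ = (PI + PJ).eval _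
    rw [eval_add, eval_add, ← hPI _ (le_max_right _ _), ← hPJ _ (le_max_right _ _),
      ← hPinf _ (le_max_right _ _), ← hPsup _ (le_max_right _ _)]
    exact_mod_cast hilbert_inf_add_hilbert_sup hI hJ _
  have := congrArg (fun R : ℚ[X] => R.coeff b) hid
  simp only [coeff_add, hb, add_zero] at this
  exact this

/-! ## Bézout's Lemma in leading-coefficient form -/

/-- The top coefficient of `P(T + d) - P(T)` vanishes. [folklore] -/
theorem coeff_taylor_sub_natDegree (P : ℚ[X]) (d : ℚ) :
    (taylor d P - P).coeff P.natDegree = 0 := by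
  rw [coeff_sub, taylor_coeff, sub_eq_zero]
  have hdeg : (hasseDeriv P.natDegree P).natDegree ≤ 0 := by
    have := natDegree_hasseDeriv_le P P.natDegree
    rwa [Nat.sub_self] at this
  rw [eq_C_of_natDegree_le_zero hdeg, eval_C, hasseDeriv_coeff, zero_add, Nat.choose_self,
    Nat.cast_one, one_mul]

/-- The coefficient of `T^{e-1}` in `P(T + d) - P(T)`, `e = deg P ≥ 1`, is `d · e · lc P`.
[folklore] -/
theorem coeff_taylor_sub_natDegree_sub_one (P : ℚ[X]) (d : ℚ) (he : 1 ≤ P.natDegree) :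
    (taylor d P - P).coeff (P.natDegree - 1) = d * P.natDegree * P.leadingCoeff := by
  set e := P.natDegree with hedef
  rw [coeff_sub, taylor_coeff]
  have hdeg : (hasseDeriv (e - 1) P).natDegree < 2 := by
    have := natDegree_hasseDeriv_le P (e - 1)
    omega
  rw [eval_eq_sum_range' hdeg, Finset.sum_range_succ, Finset.sum_range_succ, Finset.sum_range_zero,
    zero_add, pow_zero, mul_one, pow_one, hasseDeriv_coeff, hasseDeriv_coeff, zero_add,
    Nat.choose_self, Nat.cast_one, one_mul, show 1 + (e - 1) = e by omega]
  have hch : (e.choose (e - 1) : ℚ) = e := by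
    obtain ⟨k, hk⟩ : ∃ k, e = k + 1 := ⟨e - 1, by omega⟩
    rw [hk, Nat.add_sub_cancel, Nat.choose_succ_self_right]
  rw [hch, Polynomial.leadingCoeff, ← hedef]
  ring

/-- **`P(T + d) - P(T)` has degree `deg P - 1` and leading coefficient `d · deg P · lc P`** for
`d ≠ 0`, `deg P ≥ 1`. [folklore] -/
theorem natDegree_taylor_sub (P : ℚ[X]) {d : ℚ} (hd : d ≠ 0) (he : 1 ≤ P.natDegree) :
    (taylor d P - P).natDegree = P.natDegree - 1 ∧
      (taylor d P - P).leadingCoeff = d * P.natDegree * P.leadingCoeff := by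
  have hP0 : P ≠ 0 := by rintro rfl; simp at he
  have hc := coeff_taylor_sub_natDegree_sub_one P d he
  have hne : (taylor d P - P).coeff (P.natDegree - 1) ≠ 0 := by
    rw [hc]
    refine mul_ne_zero (mul_ne_zero hd ?_) (leadingCoeff_ne_zero.mpr hP0)
    exact_mod_cast (show P.natDegree ≠ 0 by omega)
  have hle : (taylor d P - P).natDegree ≤ P.natDegree - 1 := by
    have h1 : (taylor d P - P).natDegree ≤ P.natDegree :=
      (natDegree_sub_le _ _).trans (by rw [natDegree_taylor, max_self])
    -- the top coefficient vanishes, so the degree is `< natDegree P`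
    rcases h1.lt_or_eq with hlt | heq
    · omega
    · exfalso
      have h0 := coeff_taylor_sub_natDegree P d
      have hR0 : taylor d P - P ≠ 0 := fun h => hne (by rw [h, coeff_zero])
      rw [← heq] at h0
      exact (leadingCoeff_ne_zero.mpr hR0) h0
  have hdeg : (taylor d P - P).natDegree = P.natDegree - 1 :=
    le_antisymm hle (le_natDegree_of_ne_zero hne)
  exact ⟨hdeg, by rw [Polynomial.leadingCoeff, hdeg, hc]⟩

/-- **Bézout's Lemma, leading-coefficient form** (LNM 1752 Ch. 11 §2.2 (iii): for `P` not in any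
associated prime of `I`, `deg (I, P) = deg P · deg I`, whence `𝓗((I,P); D) ≤ 𝓗(I; D)` for
`D ≥ deg P`; Philippon 1986 Lemme 3.1), in the inequality form needed for counting: let `J` be a
homogeneous ideal with Hilbert polynomial `P_J` of degree `e ≥ 1`, `Q` a form of degree `D ≥ 1`
which is a non-zero-divisor modulo `J`, and `J' ⊇ J + (Q)` a homogeneous ideal whose Hilbert
polynomial `P_{J'}` has degree `e - 1`. Then `lc(P_{J'}) ≤ D · e · lc(P_J)`.
[cite: NesterenkoPhilippon2001, Ch. 11 §2.2 (iii)] -/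
theorem leadingCoeff_hilbertPolynomial_le_of_hypersurface {J J' : Ideal (MvPolynomial (Fin m) K)}
    (hJ : J.IsHomogeneous (MvPolynomial.homogeneousSubmodule (Fin m) K)) {Q : MvPolynomial (Fin m) K}
    (hQ0 : Q ≠ 0) {D : ℕ} (hQ : Q.IsHomogeneous D) (hnzd : ∀ f, Q * f ∈ J → f ∈ J)
    (hJ' : J ⊔ Ideal.span {Q} ≤ J') {PJ PJ' : ℚ[X]} {t₀ : ℕ}
    (hPJ : ∀ t, t₀ ≤ t → ((hilb(J, t) : ℕ) : ℚ) = PJ.eval (t : ℚ))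
    (hPJ' : ∀ t, t₀ ≤ t → ((hilb(J', t) : ℕ) : ℚ) = PJ'.eval (t : ℚ))
    (he : 1 ≤ PJ.natDegree) (hdeg : PJ'.natDegree = PJ.natDegree - 1) (hD : 1 ≤ D) :
    PJ'.leadingCoeff ≤ (D : ℚ) * PJ.natDegree * PJ.leadingCoeff := by
  -- the comparison `P_{J'}(t + D) ≤ P_J(t + D) - P_J(t)` for `t ≥ t₀`
  have hcmp : ∀ t : ℕ, t₀ ≤ t →
      (taylor (D : ℚ) PJ').eval (t : ℚ) ≤ (taylor (D : ℚ) PJ - PJ).eval (t : ℚ) := by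
    intro t ht
    rw [taylor_eval, eval_sub, taylor_eval, ← Nat.cast_add, ← hPJ' _ (by omega), ← hPJ _ (by omega),
      ← hPJ _ ht]
    have h1 := hilbert_sup_span_add_hilbert_eq hJ hQ0 hQ hnzd t
    have h2 := hilbert_antitone hJ' (t + D)
    have h3 : ((hilb(J', t + D) : ℕ) : ℚ) ≤ ((hilb(J ⊔ Ideal.span {Q}, t + D) : ℕ) : ℚ) := by
      exact_mod_cast h2
    have h4 : ((hilb(J ⊔ Ideal.span {Q}, t + D) : ℕ) : ℚ) + (hilb(J, t) : ℕ) = (hilb(J, t + D) : ℕ) := by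
      exact_mod_cast h1
    linarith
  obtain ⟨hRdeg, hRlc⟩ := natDegree_taylor_sub PJ (d := (D : ℚ))
    (by exact_mod_cast (show D ≠ 0 by omega)) he
  -- compare top coefficients in degree `e - 1`
  by_contra hlt
  push Not at hlt
  set R : ℚ[X] := (taylor (D : ℚ) PJ - PJ) - taylor (D : ℚ) PJ' with hR
  have hcoeff : R.coeff (PJ.natDegree - 1) =
      (D : ℚ) * PJ.natDegree * PJ.leadingCoeff - PJ'.leadingCoeff := by
    rw [hR, coeff_sub, ← hRdeg, ← Polynomial.leadingCoeff, hRlc, hRdeg, ← hdeg,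
      ← natDegree_taylor PJ' (D : ℚ), ← Polynomial.leadingCoeff, leadingCoeff_taylor]
  have hneg : R.coeff (PJ.natDegree - 1) < 0 := by rw [hcoeff]; linarith
  have hRle : R.natDegree ≤ PJ.natDegree - 1 := by
    rw [hR]
    refine (natDegree_sub_le _ _).trans (max_le hRdeg.le ?_)
    rw [natDegree_taylor, hdeg]
  have hRdeg' : R.natDegree = PJ.natDegree - 1 :=
    le_antisymm hRle (le_natDegree_of_ne_zero hneg.ne)
  have hR0 : R ≠ 0 := fun h => hneg.ne (by rw [h, coeff_zero])
  have hpos := leadingCoeff_pos_of_eventually_nonneg hR0 (t₀ := t₀) fun t ht => by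
    rw [hR, eval_sub, sub_nonneg]
    exact hcmp t ht
  rw [Polynomial.leadingCoeff, hRdeg'] at hpos
  linarith

end Literature.RingTheory.MvPolynomial

end
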